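import Summits.BirchSwinnertonDyer.BirchSwinnertonDyer.Theorems.ByReductionTypeAtTwoRankOneAtTwoBigImageOddLocalOneDoorBottomLeavesLines
import Summits.BirchSwinnertonDyer.BirchSwinnertonDyer.Theorems.ByReductionTypeAtTwoRankOneAtTwoBigImageOddLocalOneDoorBottomReciprocity
import HarnessLib

/-!
# Route ByReductionTypeAtTwo, crux `RankOneAtTwoBigImageOddLocal` (stmt-BirchSwinnertonDyer-23715), LINE v8.9 `one_door_analytic`:
# the fields `rec₁` / `rec₂` of `FirstDescentInput` at the ARCHIMEDEAN error place (`Δ_W > 0` corner, `q₀ = Sum.inr ∞`)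

Width prover seat `bsd-line-fkl-p2` g10 (2026-08-28), `--supports stmt-BirchSwinnertonDyer-23715` (helper).  THEOREMS ONLY.  BSD is not proved by
any of this.  Sibling of `…OneDoorBottomLeavesRec.lean` (finite error place): Poitou–Tate with the error place `∞`
(`…OneDoorBottomReciprocity` §2 at `v₀ = Sum.inl w` in gk2's `Place ℚ`) + Tate local duality at a (regular) Kolyvagin prime whose count
`#X(ℚ_ℓ)[2] = 2` is displayed (at `(Δ/ℓ) = −1` it is `natCard_ker_nsmul_adicCompletion_two_eq_two_of_jacobiSym`), re-indexed into the lead's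
currency (`RatPlace`, `locAt`, `strictAt`, literal level `2`; the strict condition at `∞` read by `mem_torsionLocalKer_completion_iff`).

References: [GrossLMS1991] Prop. 8.2, §10; [McCallumLMS1991] Lemma 5.3; [Kramer1981] Prop. 6; MEMO-es §18.11 (U₀⁺).
-/

set_option autoImplicit false
-- the Theorems namespace of this sub repeats the summit name by design (D-0017 nested layout)
set_option linter.dupNamespace false

noncomputable section

open scoped Classical

namespace Summit.BirchSwinnertonDyer.BirchSwinnertonDyer.Theorems.RankOneAtTwoOneDoor

open WeierstrassCurve NumberField IsDedekindDomain Field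
open Literature.NumberTheory.EllipticCurves Literature.NumberTheory.GaloisRepresentations
open Literature.NumberTheory.GaloisCohomology
open Summit.BirchSwinnertonDyer.BirchSwinnertonDyer.Theorems.GenusExact

/-- Re-indexing `RatPlace → Place ℚ` off a finite place and the infinite place. [folklore] -/
theorem forall_place_of_forall_ratPlace_inf₂ (X : WeierstrassCurve ℚ) {v : HeightOneSpectrum (𝓞 ℚ)} {w₀ : InfinitePlace ℚ}
    {d : galH1Torsion X 2} (hd : ∀ w : RatPlace, w ≠ Sum.inl v → w ≠ Sum.inr w₀ → d ∈ locAt X 2 w) :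
    ∀ w : Place ℚ, w ≠ Sum.inr v → w ≠ Sum.inl w₀ → d ∈ selmerLocalKer X (Place.Completion w) ((2 : ℕ) : ℤ) := by
  rintro (w | w) h1 h2
  · exact hd (Sum.inr w) Sum.inr_ne_inl (fun h => h2 (by rw [Sum.inr_injective h]))
  · exact hd (Sum.inl w) (fun h => h1 (by rw [Sum.inl_injective h])) Sum.inl_ne_inr

/-- Re-indexing `RatPlace → Place ℚ` off the infinite place. [folklore] -/
theorem forall_place_of_forall_ratPlace_inf₁ (X : WeierstrassCurve ℚ) {w₀ : InfinitePlace ℚ} {s : galH1Torsion X 2}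
    (hs : ∀ w : RatPlace, w ≠ Sum.inr w₀ → s ∈ locAt X 2 w) :
    ∀ w : Place ℚ, w ≠ Sum.inl w₀ → s ∈ selmerLocalKer X (Place.Completion w) ((2 : ℕ) : ℤ) := by
  rintro (w | w) h1
  · exact hs (Sum.inr w) (fun h => h1 (by rw [Sum.inr_injective h]))
  · exact hs (Sum.inl w) Sum.inl_ne_inr

/-- **Field `rec₁` / `rec₂` with the REAL error place** (`q₀ = Sum.inr w₀`, the `Δ > 0` corner) from the count `#X(ℚ_v)[2] = 2` at an odd
prime `ℓ ∣ v` (a REGULAR Kolyvagin prime: `Frob_ℓ` a transposition on `E[2]`, i.e. `(Δ/ℓ) = −1`, count by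
`natCard_ker_nsmul_adicCompletion_two_eq_two_of_jacobiSym`): Poitou–Tate with the error place `∞` (`…OneDoorBottomReciprocity` §2) + Tate local
duality at `ℓ`. [cite: GrossLMS1991, §10, Prop. 8.2] [cite: McCallumLMS1991, §5 Lemma 5.3] [cite: Kramer1981, Prop. 6] -/
theorem rec_inr_of_card (X : WeierstrassCurve ℚ) [X.IsElliptic] {ℓ : ℕ} [Fact ℓ.Prime] (hℓ2 : ℓ ≠ 2)
    {v : HeightOneSpectrum (𝓞 ℚ)} (hℓv : (ℓ : 𝓞 ℚ) ∈ v.asIdeal)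
    (hcard : Nat.card (nsmulAddMonoidHom 2 : (X.baseChange (v.adicCompletion ℚ)).toAffine.Point →+ _).ker = 2)
    (w₀ : InfinitePlace ℚ) :
    ∀ d : galH1Torsion X 2, (∀ w : RatPlace, w ≠ Sum.inl v → w ≠ Sum.inr w₀ → d ∈ locAt X 2 w) → d ∉ locAt X 2 (Sum.inl v) →
      ∀ s : galH1Torsion X 2, (∀ w : RatPlace, w ≠ Sum.inr w₀ → s ∈ locAt X 2 w) → s ∉ strictAt X 2 (Sum.inl v) →
        s ∉ strictAt X 2 (Sum.inr w₀) := by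
  intro d hd hdv s hs hsv hs₀
  apply hsv
  have h2v : ((2 : ℕ) : 𝓞 ℚ) ∉ v.asIdeal := LocalDualityOrder.two_notMem_of_odd_prime_mem hℓ2 hℓv
  have hs₀' : galoisCohomology.localization (X.torsionGaloisModule ((2 : ℕ) : ℤ)) (Sum.inl w₀) 1 s = 0 :=
    (mem_torsionLocalKer_completion_iff X w₀ two_ne_zero s).mp hs₀
  have hdv' : ((2 : ℤ) ^ 0) • d ∉ selmerLocalKer X (v.adicCompletion ℚ) ((2 : ℕ) : ℤ) := by rw [pow_zero, one_smul]; exact hdv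
  have h := pow_smul_mem_torsionLocalKer_of_relaxed_of_card_torsion_eq' X Nat.prime_two one_ne_zero (q := 2) (pow_one 2).symm
    v h2v (M := 1) (by rw [pow_one]; exact hcard) (Sum.inl w₀) Sum.inl_ne_inr (forall_place_of_forall_ratPlace_inf₁ X hs) hs₀'
    (forall_place_of_forall_ratPlace_inf₂ X hd) (a := 0) (by exact_mod_cast hdv')
  simpa using h

end Summit.BirchSwinnertonDyer.BirchSwinnertonDyer.Theorems.RankOneAtTwoOneDoor

end
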